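import Summits.MatrixMultiplication.MatrixMultiplication.Theorems.LevelGradedCohnUmansLevelOneGL2DesignsHermitianLift
import Literature.NumberTheory.NumberFields.SmallNormReduction
import Literature.NumberTheory.NumberFields.TraceFormCM

/-!
# The CM-Hermitian lift: tangency sets of `AG(2,p)` from the integers of a CM field
(wall-breaker axis `Hermitian unital constructions`, stub `stub_tangencySets` of the crux `LevelOneGL2Designs`,
stmt-MatrixMultiplication-14080, k7 — file 2: the abstract number-field step)

Let `K` be a CM field, `c` its complex conjugation (a ring involution of `𝓞_K`), `φ : 𝓞_K → ℤ/p` a SURJECTIVE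
ring map (reduction modulo a degree-one prime).  For finite `X, U ⊆ 𝓞_K` with `Tr_{K/ℚ}` CONSTANT on `U`, the
points `(x, x·cx + u)` with the unital's tangent lines `Y − y' = 2·c(x')·(X − x')` reduce under `φ` to an affine
tangency set of `AG(2,p)` with exactly `|X|·|U|` points, PROVIDED the relevant differences
`F = 2(x − x')·cx' − ((x·cx + u) − (x'·cx' + u'))` have `|N_{K/ℚ}(F)| < p` (`exists_tangencySet_cmLift`).
Indeed (`…HermitianLift.tangencySet_of_hermitianLift_graph`) it suffices that (i) `φ F = 0 ⇒ F = 0` — the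
no-wrap-around principle `Literature…eq_zero_of_map_eq_zero_of_natAbs_norm_lt` — and (ii) the height difference
`(u' + cu') − (u + cu)` is never a non-trivial `2(x − x')·c(x − x')` — true because its trace vanishes while
`Tr(z·cz) > 0` for `z ≠ 0` on a CM field (`Literature…eq_of_trace_eq_of_sub_eq_two_mul_norm`).

This is the Hermitian-unital analogue of Pohoata's trace-zero PARABOLA lift over totally real fields
(arXiv:2607.20422, Prop. 5.1; the case `c = id` of the same identity): the unital `y + ȳ = 2x x̄` does lift to
prime fields once Frobenius is replaced by complex conjugation on a CM order and the subfield `𝔽_q ⊂ 𝔽_{q²}`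
by the trace-zero hyperplane.  With boxes in `𝓞_K`, `[K:ℚ] = n`, it yields `≍ p^{3/2 − 1/n}` points
(`…HermitianLiftCyclotomic`).  No definitions.
-/

-- the summit/problem path `MatrixMultiplication.MatrixMultiplication` is fixed by the tree layout (D-0017)
set_option linter.dupNamespace false

noncomputable section

open Finset Matrix NumberField

namespace Summit.MatrixMultiplication.MatrixMultiplication.Theorems.LevelOneGL2Designs.HermitianLift

/-- **The CM-Hermitian lift.**  `K` a CM field; `σ : 𝓞_K → 𝓞_K` a ring map inducing complex conjugation on `K`;
`φ : 𝓞_K → ZMod p` a surjective ring map; `X, U ⊆ 𝓞_K` finite with `Tr_{K/ℚ}` constant on `U`; and the norm window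
`|N_{K/ℚ}(2(x − x')σx' − ((xσx + u) − (x'σx' + u')))| < p` on `X, U`.  Then `AG(2,p)` contains an affine tangency set —
every point on a line meeting the set only there — with exactly `|X|·|U|` points: the reductions of the points
`(x, xσx + u)` of the unitals `Y + σY = 2Xσ X + (u + σu)` with their tangent lines.  (No wrap-around by the norm
window and the surjectivity of `φ`; no collisions because a trace-zero relative norm vanishes on a CM field.)
[this project; the `σ = id` / totally real analogue is Pohoata, arXiv:2607.20422, Prop. 5.1] -/
theorem exists_tangencySet_cmLift {K : Type*} [Field K] [NumberField K] [IsCMField K] {p : ℕ} [Fact p.Prime]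
    (σ : 𝓞 K →+* 𝓞 K) (hσ : ∀ z : 𝓞 K, ((σ z : 𝓞 K) : K) = IsCMField.complexConj K (z : K))
    (φ : 𝓞 K →+* ZMod p) (hφ : Function.Surjective φ) (X U : Finset (𝓞 K))
    (hU : ∀ u ∈ U, ∀ u' ∈ U, Algebra.trace ℚ K (u : K) = Algebra.trace ℚ K (u' : K))
    (hW : ∀ x ∈ X, ∀ x' ∈ X, ∀ u ∈ U, ∀ u' ∈ U,
      (Algebra.norm ℤ (2 * (x - x') * σ x' - ((x * σ x + u) - (x' * σ x' + u')))).natAbs < p) :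
    ∃ W : Finset (Fin 2 → ZMod p), W.card = X.card * U.card ∧
      ∀ v ∈ W, ∃ u : Fin 2 → ZMod p, u ≠ 0 ∧ ∀ w ∈ W, u ⬝ᵥ w = u ⬝ᵥ v → w = v := by
  -- `σ` is an involution (it is complex conjugation on `K`, and `𝓞 K → K` is injective)
  have hσσ : ∀ z : 𝓞 K, σ (σ z) = z := fun z =>
    RingOfIntegers.ext (by rw [hσ, hσ, IsCMField.complexConj_apply_apply])
  refine tangencySet_of_hermitianLift_graph σ hσσ φ X U ?_ ?_
  · -- (i) no wrap-around
    intro x hx x' hx' u hu u' hu' h0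
    exact Literature.NumberTheory.NumberFields.eq_zero_of_map_eq_zero_of_natAbs_norm_lt φ hφ h0
      (hW x hx x' hx' u hu u' hu')
  · -- (ii) heights: pass to `K` and use the positivity of the Hermitian trace form
    intro x hx x' hx' u hu u' hu' h
    have hσ' : ∀ z : 𝓞 K, algebraMap (𝓞 K) K (σ z) = IsCMField.complexConj K (algebraMap (𝓞 K) K z) := hσ
    have hK := congrArg (algebraMap (𝓞 K) K) h
    simp only [map_sub, map_add, map_mul, map_ofNat, hσ'] at hK
    rw [← map_sub (IsCMField.complexConj K)] at hK
    exact RingOfIntegers.ext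
      (Literature.NumberTheory.NumberFields.eq_of_trace_eq_of_sub_eq_two_mul_norm (hU u hu u' hu') hK)

end Summit.MatrixMultiplication.MatrixMultiplication.Theorems.LevelOneGL2Designs.HermitianLift
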